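import Summits.BirchSwinnertonDyer.BirchSwinnertonDyer.Theorems.AdditiveKolyvaginRoadToricIsotropy
import Literature.NumberTheory.EllipticCurves.ZpExtensionUnramifiedProofs
import Literature.NumberTheory.EllipticCurves.SelmerUnramified
import Literature.NumberTheory.EllipticCurves.H1UnramifiedFinite
import Literature.NumberTheory.EllipticCurves.GaloisActionProofs
import HarnessLib

/-!
# Line `admdef` (crux `AnticyclotomicEisensteinDivisibility`, stmt-BirchSwinnertonDyer-20727), rigidity road (M1): UNRAMIFIED classes are
# ISOTROPIC for the local Weil cup product at a place where `E[n]` is RAMIFIED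

LEAD seat bsd-line-sbc-p1 (gen 28), `--supports stmt-BirchSwinnertonDyer-20727` (helper; OFF the v23 composition path; the local input at the BAD
places of CHKLL25's `m`-ordinary signed Selmer groups — whose condition at `ℓ ∣ N` is «unramified» (flag `away-p-unr`), not Kummer — for the
Poitou–Tate see-saw behind Howard's vanishing lemma).  For an elliptic curve `E = W` over a number field `K`, a prime `n`, a finite place `v`
at which `E[n](K̄)` is RAMIFIED (some element of an inertia group above `v` moves some `n`-torsion point — hypothesis (ii) of CHKLL25 Thm. 7.1
«`E[p]` ramified at every `q ∣ N`» in the base-changed currency), and two classes `y, z ∈ H¹(K, E[n])` UNRAMIFIED at every prime of `K̄` over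
`v` (`unramifiedKer`): the local Weil cup product of `loc_v y` and `loc_v z` VANISHES.

PROOF (`weilCupProduct_localization_eq_zero_of_unramified_of_ramified`).  At the prime `𝔓 = 𝔓_{ι₀,𝔐}` cut out by the chosen embedding (so that
`res(Γ_{K_v}) ⊆ D_𝔓`): an unramified class has a cocycle `ψ` VANISHING on `I_𝔓` (subtract the coboundary `∂a` of `ψ|_{I_𝔓} = ∂a`); such a
cocycle takes values in the fixed group `A = E[n]^{I_𝔓}` on `D_𝔓` (`i ψ(g) = ψ(ig) = ψ(g · g⁻¹ig) = ψ(g)`, `I_𝔓 ⊴ D_𝔓`); `A` is a PROPER subgroup of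
`E[n] ≅ (ℤ/n)²` (the ramification hypothesis, moved to `𝔓` by conjugation), hence of order `≤ n`, hence cyclic and isotropic for the alternating
Weil pairing (AKR `weilPairingHom_eq_zero_of_mem_of_card_le`); and two classes with `A`-valued representatives have cup product zero (AKR
`weilCupProduct_res_eq_zero_of_valued`).  (At a place where `E[n]` is unramified the statement is still true — cup products of classes
inflated from `Ẑ` vanish — but is not proved here.)

* §1 `fixedBy_inertia_ne_top_of_ramified` bookkeeping (as statements inside the proof; no definition is introduced); §2 the theorem.

HONEST FRAMING: theorems only (no definition, no named fact, no `sorry`); nothing about the crux or BSD is asserted.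

References: [cite: MilneADT2006, Ch. I §2 (local duality), Thm. 4.10] [cite: SilvermanAEC2009, Prop. III.8.1 (Weil pairing alternating), VIII.§2]
[cite: CastellaEtAl2025, Thm. 7.1 (ii), §7.2 (arXiv:2308.10474v2 pp. 29–30)] [cite: NeukirchANT1999, Ch. I §9 (9.4), Ch. II §9 (9.6)].
-/

-- D-0017: single-problem summit, the namespace repeats the problem name by design.
set_option linter.dupNamespace false
set_option autoImplicit false

noncomputable section

open scoped Classical NumberField Pointwise

namespace Summit.BirchSwinnertonDyer.BirchSwinnertonDyer.Theorems.SignedBaseChangeAcDivAdmdefUnramifiedIsotropy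

open CategoryTheory WeierstrassCurve Field Function NumberField IsDedekindDomain
open Literature.NumberTheory.EllipticCurves Literature.NumberTheory.GaloisRepresentations
open Summit.BirchSwinnertonDyer.BirchSwinnertonDyer.Theorems.AdditiveKoly
open scoped ContRepresentation

universe u

variable {K : Type u} [Field K] [NumberField K] (W : WeierstrassCurve K) (n : ℕ) [Fact n.Prime] [W.IsElliptic]
variable (e : geomTorsion W n → geomTorsion W n → AlgebraicClosure K)
  (hμ : ∀ S T, e S T ^ n = 1)
  (hadd₁ : ∀ S₁ S₂ T, e (S₁ + S₂) T = e S₁ T * e S₂ T)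
  (hadd₂ : ∀ S T₁ T₂, e S (T₁ + T₂) = e S T₁ * e S T₂)
  (hgal : ∀ (σ : absoluteGaloisGroup K) (S T : geomTorsion W n), σ • e S T = e (σ • S) (σ • T))


omit [Fact n.Prime] [W.IsElliptic] in
/-- **An unramified class has an `E[n]^{I_𝔓}`-valued representative on `Γ_{K_v}`** (at the prime `𝔓 = 𝔓_{ι₀,𝔐}` of the chosen embedding): for
`y ∈ H¹(K, E[n])` unramified at `𝔓`, the restriction `res_{K_v} y` is the class of a cocycle of `E[n](K̄)|_{Γ_{K_v}}` all of whose values are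
fixed by the inertia group `I_𝔓`. [cite: SilvermanAEC2009, VIII.§2 Definition p. 191] [cite: NeukirchANT1999, Ch. II §9 (9.6)] -/
theorem exists_inertia_fixed_cocycle_of_mem_unramifiedKer (v : HeightOneSpectrum (𝓞 K))
    {𝔐 : Ideal (HeightOneSpectrum.localAbsIntegers v)} (h𝔐 : 𝔐 ∈ v.localPrimesAbove)
    {y : galH1Torsion W (n : ℤ)}
    (hy : y ∈ unramifiedKer (geomTorsion W (n : ℤ)) (v.primeBelow (closureEmb (K := K) (v.adicCompletion K)) 𝔐)) :
    ∃ ψ : contOneCocycles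
        (DiscreteGaloisModule.toTopRep (GaloisRep.restrictField (v.adicCompletion K) (W.torsionGaloisModule n))),
      (∀ (σ : absoluteGaloisGroup (v.adicCompletion K))
          (i : absoluteGaloisGroup K), i ∈ (v.primeBelow (closureEmb (K := K) (v.adicCompletion K)) 𝔐).inertia (absoluteGaloisGroup K) →
          i • ψ.1 σ = ψ.1 σ) ∧
        oneCocycleClass _ ψ = galoisCohomology.res (W.torsionGaloisModule n) (v.adicCompletion K) 1 y := by
  set ι₀ := closureEmb (K := K) (v.adicCompletion K) with hι₀
  set 𝔓 := v.primeBelow ι₀ 𝔐 with h𝔓def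
  set M := geomTorsion W (n : ℤ) with hM
  haveI := continuousSMul_geomTorsion W (isOpen_stabilizer_point_holds W) (n : ℤ)
  obtain ⟨φ, rfl⟩ := oneCocycleClass_surjective (discreteTopRep (absoluteGaloisGroup K) M) y
  obtain ⟨a, ha⟩ := (oneCocycleClass_mem_subgroupResKer_iff _ φ).mp hy
  -- the coboundary of `a` and the cocycle `φ₂ = φ − ∂a`, which VANISHES on `I_𝔓`
  let δ : contOneCocycles (discreteTopRep (absoluteGaloisGroup K) M) :=
    ⟨⟨fun σ ↦ σ • a - a, (continuous_id.smul continuous_const).sub continuous_const⟩, fun g h ↦ by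
      change (g * h) • a - a = (g • a - a) + (discreteTopRep (absoluteGaloisGroup K) M).ρ g (h • a - a)
      rw [discreteTopRep_ρ_apply, smul_sub, mul_smul]; abel⟩
  have hδ : ∀ σ : absoluteGaloisGroup K, δ.1 σ = σ • a - a := fun _ ↦ rfl
  have hδ0 : oneCocycleClass _ δ = 0 := (oneCocycleClass_eq_zero_iff _ δ).mpr ⟨a, fun g ↦ by rw [hδ, discreteTopRep_ρ_apply]⟩
  set φ₂ := φ - δ with hφ₂def
  have hφ₂ : ∀ σ : absoluteGaloisGroup K, φ₂.1 σ = φ.1 σ - (σ • a - a) := fun σ ↦ rfl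
  have hφ₂class : oneCocycleClass _ φ₂ = oneCocycleClass _ φ := by
    rw [hφ₂def, oneCocycleClass_sub, hδ0, sub_zero]
  have hφ₂I : ∀ i ∈ 𝔓.inertia (absoluteGaloisGroup K), φ₂.1 i = 0 := fun i hi ↦ by
    rw [hφ₂, ha ⟨i, hi⟩, Subgroup.coe_mk, sub_self]
  -- `φ₂` is `E[n]^{I_𝔓}`-valued on `D_𝔓`
  have hfix : ∀ g ∈ 𝔓.decompositionSubgroup (absoluteGaloisGroup K), ∀ i ∈ 𝔓.inertia (absoluteGaloisGroup K),
      i • φ₂.1 g = φ₂.1 g := by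
    intro g hg i hi
    haveI : 𝔓.IsPrime := (v.primeBelow_mem_primesAbove h𝔐).1
    -- `g⁻¹ i g ∈ I_𝔓`
    have hconj : g⁻¹ * i * g ∈ 𝔓.inertia (absoluteGaloisGroup K) := by
      have hg' : g • 𝔓 = 𝔓 := hg
      have h := (HeightOneSpectrum.mem_inertia_smul_absIntegers_iff g i 𝔓).mp (by rw [hg']; exact hi)
      exact h
    have h1 : φ₂.1 (i * g) = i • φ₂.1 g := by
      rw [φ₂.2 i g, discreteTopRep_ρ_apply, hφ₂I i hi, zero_add]
    have h2 : φ₂.1 (i * g) = φ₂.1 g := by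
      have : i * g = g * (g⁻¹ * i * g) := by group
      rw [this, φ₂.2 g (g⁻¹ * i * g), discreteTopRep_ρ_apply, hφ₂I _ hconj, smul_zero, add_zero]
    rw [← h1, h2]
  -- the local cocycle `φ₂ ∘ res`
  refine ⟨contOneCocycles.pullback (absGaloisRestrict K (v.adicCompletion K))
      (X := discreteTopRep (absoluteGaloisGroup K) M)
      (Y := DiscreteGaloisModule.toTopRep (GaloisRep.restrictField (v.adicCompletion K) (W.torsionGaloisModule n)))
      (TopRep.ofHom ⟨ContinuousLinearMap.id ℤ M, fun _ => rfl⟩) φ₂, fun σ i hi ↦ ?_, ?_⟩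
  · rw [contOneCocycles.pullback_apply]
    change i • φ₂.1 (absGaloisRestrict K (v.adicCompletion K) σ) = φ₂.1 (absGaloisRestrict K (v.adicCompletion K) σ)
    refine hfix _ ?_ i hi
    rw [← resGal_eq_absGaloisRestrict, resGal_eq]
    exact resGalOfEmb_mem_decompositionSubgroup ι₀ h𝔐 σ
  · rw [← res_torsionGaloisModule_oneCocycleClass, hφ₂class]

/-- **Unramified classes are isotropic at a place where `E[n]` is ramified.**  `E = W` elliptic over a number field `K`, `n` prime, `e` a
(non-degenerate, alternating, Galois-equivariant) Weil pairing on `E[n]`, `v` a finite place such that SOME element of SOME inertia group above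
`v` moves SOME point of `E[n](K̄)` (i.e. `E[n]` is ramified at `v`); `y, z ∈ H¹(K, E[n])` unramified at every prime of `K̄` above `v`.  Then the
local Weil cup product `loc_v y ∪ₑ loc_v z ∈ H²(K_v, μ_n)` is ZERO (stated, as AKR's `weilCupProduct_res_eq_zero_of_valued`, for the restriction
of `weilContPairing` along `Γ_{K_v} → Γ_K` and `galoisCohomology.res`; this IS `weilContPairingLocal … (Sum.inr v)` on `galoisCohomology.localization`,
definitionally).  Proof in the module docstring (fixed-point-valued representatives; a proper
subgroup of `(ℤ/n)²` has order `≤ n` and is isotropic).  (The compactness of the absolute Galois groups and the finiteness of `E[n]` — local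
instances in the tree's cup-product files — are instance binders here, as in AKR `weilCupProduct_res_eq_zero_of_valued`.)
[cite: MilneADT2006, Ch. I §2] [cite: SilvermanAEC2009, Prop. III.8.1] [cite: CastellaEtAl2025, Thm. 7.1 (ii) (arXiv:2308.10474v2 p0029)] -/
theorem weilCupProduct_localization_eq_zero_of_unramified_of_ramified (halt : ∀ T, e T T = 1) (v : HeightOneSpectrum (𝓞 K))
    [CompactSpace (absoluteGaloisGroup K)] [CompactSpace (absoluteGaloisGroup (v.adicCompletion K))]
    [Finite (geomTorsion W (n : ℤ))]
    (hram : ∃ 𝔓 ∈ v.primesAbove, ∃ τ ∈ 𝔓.inertia (absoluteGaloisGroup K), ∃ P : geomTorsion W (n : ℤ), τ • P ≠ P)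
    {y z : galH1Torsion W (n : ℤ)}
    (hy : ∀ 𝔓 ∈ v.primesAbove, y ∈ unramifiedKer (geomTorsion W (n : ℤ)) 𝔓)
    (hz : ∀ 𝔓 ∈ v.primesAbove, z ∈ unramifiedKer (geomTorsion W (n : ℤ)) 𝔓) :
    ((weilContPairing W n e hμ hadd₁ hadd₂ hgal).restrict (absGaloisRestrict K (v.adicCompletion K))).cupProduct
      (galoisCohomology.res (W.torsionGaloisModule n) (v.adicCompletion K) 1 y)
      (galoisCohomology.res (W.torsionGaloisModule n) (v.adicCompletion K) 1 z) = 0 := by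
  have hn : n.Prime := Fact.out
  have hT : Nat.card (geomTorsion W (n : ℤ)) = n ^ 2 :=
    card_torsionPoints_eq_sq_holds W (AlgebraicClosure K) (n := n) (by exact_mod_cast hn.ne_zero)
  set ι₀ := closureEmb (K := K) (v.adicCompletion K) with hι₀
  obtain ⟨𝔐, h𝔐⟩ := v.localPrimesAbove_nonempty
  set 𝔓 := v.primeBelow ι₀ 𝔐 with h𝔓def
  have h𝔓 : 𝔓 ∈ v.primesAbove := v.primeBelow_mem_primesAbove h𝔐
  -- the fixed group `A = E[n]^{I_𝔓}`
  let A : AddSubgroup (geomTorsion W (n : ℤ)) :=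
    { carrier := {m | ∀ i ∈ 𝔓.inertia (absoluteGaloisGroup K), i • m = m}
      add_mem' := fun {a b} ha hb i hi ↦ by rw [smul_add, ha i hi, hb i hi]
      zero_mem' := fun i _ ↦ smul_zero i
      neg_mem' := fun {a} ha i hi ↦ by rw [smul_neg, ha i hi] }
  have hAmem : ∀ m, m ∈ A ↔ ∀ i ∈ 𝔓.inertia (absoluteGaloisGroup K), i • m = m := fun _ ↦ Iff.rfl
  -- `A ≠ ⊤`: transport the ramification to `𝔓`
  have hAtop : A ≠ ⊤ := by
    obtain ⟨𝔓₁, h𝔓₁, τ, hτ, P, hP⟩ := hram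
    obtain ⟨g, hg⟩ := HeightOneSpectrum.exists_smul_eq_of_mem_primesAbove_holds h𝔓₁ h𝔓
    -- `g τ g⁻¹ ∈ I_{g • 𝔓₁} = I_𝔓` moves `g • P`
    have hτ' : g * τ * g⁻¹ ∈ 𝔓.inertia (absoluteGaloisGroup K) := by
      rw [← hg, HeightOneSpectrum.mem_inertia_smul_absIntegers_iff]
      have : g⁻¹ * (g * τ * g⁻¹) * g = τ := by group
      rw [this]; exact hτ
    intro htop
    have hmem : g • P ∈ A := by rw [htop]; exact AddSubgroup.mem_top _
    have h1 := (hAmem _).mp hmem _ hτ'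
    rw [mul_smul, mul_smul, inv_smul_smul] at h1
    exact hP (smul_left_cancel g h1)
  have hcardA : Nat.card A ≤ n := natCard_le_of_ne_top hn hT hAtop
  have hisoA : ∀ S ∈ A, ∀ T ∈ A, weilPairingHom W n e hμ hadd₁ hadd₂ S T = 0 :=
    fun S hS T hT' ↦ weilPairingHom_eq_zero_of_mem_of_card_le W n e hμ hadd₁ hadd₂ halt A hcardA S T hS hT'
  -- representatives valued in `A`, and the valued isotropy
  obtain ⟨ψy, hψy, hyc⟩ := exists_inertia_fixed_cocycle_of_mem_unramifiedKer W n v h𝔐 (hy 𝔓 h𝔓)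
  obtain ⟨ψz, hψz, hzc⟩ := exists_inertia_fixed_cocycle_of_mem_unramifiedKer W n v h𝔐 (hz 𝔓 h𝔓)
  exact weilCupProduct_res_eq_zero_of_valued W n (v.adicCompletion K) e hμ hadd₁ hadd₂ hgal A hisoA
    ⟨ψy, fun σ ↦ (hAmem _).mpr (hψy σ), hyc⟩ ⟨ψz, fun σ ↦ (hAmem _).mpr (hψz σ), hzc⟩

end Summit.BirchSwinnertonDyer.BirchSwinnertonDyer.Theorems.SignedBaseChangeAcDivAdmdefUnramifiedIsotropy

end
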